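import Literature.Analysis.ODE.DiagonalKernelMaximum
import HarnessLib

/-!
# The growth pairing: the diagonal Green kernel at a point where one solution grows outward and the
# other grows inward (real part of `ū v̄ W`; no flux, no sign of `ωσ`)

Topic `Literature/Analysis/ODE` (namespace `Literature.Analysis.ODE`), companion of `KernelPairing.lean`.
There the IMAGINARY part of the identity `ū v̄ (u v′ − v u′) = |u|² (v̄ v′) − |v|² (ū u′)`
(`conj_mul_conj_mul_wronskian`, `DiagonalKernelMaximum.lean`) gives the FLUX pairing
`ω|u|² + σ|v|² ≤ |u||v||W|` (`Im(ūu′) = −σ`, `Im(v̄v′) = ω`), which controls the diagonal kernel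
`|u||v|/|W|` only when the two fluxes have the same sign (`ωσ > 0`). Its REAL part,

  `|u|²·Re(v̄ v′) − |v|²·Re(ū u′) = Re(ū v̄ W)`,  hence  `| |u|² Re(v̄v′) − |v|² Re(ūu′) | ≤ |u||v||W|`,

controls the same kernel from GROWTH RATES instead: if `u` is outward-growing at the point
(`Re(ū u′) ≥ 0`, i.e. `(|u|²)′ ≥ 0`) and `v` is inward-growing at rate `k` (`Re(v̄ v′) ≤ −k|v|²`, i.e.
`(log|v|)′ ≤ −k`), then `k·|u||v| ≤ |W|` — the situation of the horizon solution (monotonically growing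
across a forbidden region, `Literature/Geometry/Lorentzian/CarterThresholdMonotone.lean`) against the
infinity solution (dominated by the recessive branch, decaying outward at the local WKB rate) INSIDE the
barrier of Carter's radial equation at the superradiant threshold, where `σ = ω − mω₊ = 0` and the flux
pairing is void. Everything is proved:

* `re_conj_mul_conj_mul_wronskian` — the real-part identity;
* `growth_pairing_abs_le` — `| |u|² Re(v̄v′) − |v|² Re(ūu′) | ≤ |u|·|v|·|u v′ − v u′|`;
* `mul_norm_le_norm_wronskian_of_growth` — `Re(ūu′) ≥ 0`, `Re(v̄v′) ≤ −k|v|²` give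
  `k|u||v| ≤ |u v′ − v u′|`; `mul_norm_le_norm_wronskian_of_growth'` — the mirror case
  (`Re(ūu′) ≥ k|u|²`, `Re(v̄v′) ≤ 0`);
* `two_point_le_norm_wronskian_of_growth` — the two-point form for `x ≤ y` when `|u|` is non-decreasing:
  `k(y)|u(x)||v(y)| ≤ |W(y)|`.

## References
* P. Hartman, *Ordinary Differential Equations* (SIAM Classics 38, 2002), Ch. XI §2 (Wronskian
  identities) and §6 (monotone positive solutions in disconjugate regions). Key `Hartman2002`.
* I. M. Gelfand, L. A. Dikii, Russian Math. Surveys 30:5 (1975) 77–113 (the diagonal resolvent kernel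
  `ψ₊ψ₋/W`).
-/

noncomputable section

open scoped ComplexConjugate

namespace Literature.Analysis.ODE

/-- **Real part of `ū v̄ W`.** `Re(ū v̄ (u v′ − v u′)) = |u|² Re(v̄ v′) − |v|² Re(ū u′)`. [folklore] -/
theorem re_conj_mul_conj_mul_wronskian (u u' v v' : ℂ) :
    (conj u * conj v * (u * v' - v * u')).re = ‖u‖ ^ 2 * (conj v * v').re - ‖v‖ ^ 2 * (conj u * u').re := by
  rw [conj_mul_conj_mul_wronskian, Complex.sub_re, Complex.re_ofReal_mul, Complex.re_ofReal_mul]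

/-- **The growth pairing inequality**: `| |u|² Re(v̄v′) − |v|² Re(ūu′) | ≤ |u|·|v|·|u v′ − v u′|`
(`|Re z| ≤ |z|`). [folklore] -/
theorem growth_pairing_abs_le (u u' v v' : ℂ) :
    |‖u‖ ^ 2 * (conj v * v').re - ‖v‖ ^ 2 * (conj u * u').re| ≤ ‖u‖ * ‖v‖ * ‖u * v' - v * u'‖ := by
  rw [← re_conj_mul_conj_mul_wronskian]
  have h := Complex.abs_re_le_norm (conj u * conj v * (u * v' - v * u'))
  rwa [norm_mul, norm_mul, Complex.norm_conj, Complex.norm_conj] at h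

/-- **Diagonal kernel from growth rates.** If `u` is outward-growing (`Re(ū u′) ≥ 0`) and `v` is
inward-growing at rate `k` (`Re(v̄ v′) ≤ −k|v|²`; any real `k`), then `k·|u||v| ≤ |u v′ − v u′|`: the growing
factors cannot cancel in the Wronskian. [folklore] -/
theorem mul_norm_le_norm_wronskian_of_growth {u u' v v' : ℂ} {k : ℝ}
    (hu : 0 ≤ (conj u * u').re) (hv : (conj v * v').re ≤ -k * ‖v‖ ^ 2) :
    k * (‖u‖ * ‖v‖) ≤ ‖u * v' - v * u'‖ := by
  have h := (abs_le.1 (growth_pairing_abs_le u u' v v')).1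
  -- `k|u|²|v|² ≤ |v|² Re(ūu′) − |u|² Re(v̄v′) ≤ |u||v||W|`
  have h1 : k * (‖u‖ ^ 2 * ‖v‖ ^ 2) ≤ ‖u‖ * ‖v‖ * ‖u * v' - v * u'‖ := by
    have hu2 : 0 ≤ ‖u‖ ^ 2 := sq_nonneg _
    have hv2 : 0 ≤ ‖v‖ ^ 2 := sq_nonneg _
    nlinarith [mul_le_mul_of_nonneg_left hv hu2, mul_nonneg hv2 hu]
  have hp : 0 ≤ ‖u‖ * ‖v‖ := by positivity
  rcases hp.lt_or_eq with hpos | hzero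
  · have h2 : k * (‖u‖ * ‖v‖) * (‖u‖ * ‖v‖) ≤ ‖u * v' - v * u'‖ * (‖u‖ * ‖v‖) := by
      calc k * (‖u‖ * ‖v‖) * (‖u‖ * ‖v‖) = k * (‖u‖ ^ 2 * ‖v‖ ^ 2) := by ring
        _ ≤ ‖u‖ * ‖v‖ * ‖u * v' - v * u'‖ := h1
        _ = ‖u * v' - v * u'‖ * (‖u‖ * ‖v‖) := by ring
    exact le_of_mul_le_mul_right h2 hpos
  · rw [← hzero, mul_zero]
    exact norm_nonneg _

/-- **Diagonal kernel from growth rates, mirror form.** If `u` is outward-growing at rate `k ≥ 0`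
(`Re(ū u′) ≥ k|u|²`; any real `k`) and `v` is inward-growing (`Re(v̄ v′) ≤ 0`), then `k·|u||v| ≤ |u v′ − v u′|`.
[folklore] -/
theorem mul_norm_le_norm_wronskian_of_growth' {u u' v v' : ℂ} {k : ℝ}
    (hu : k * ‖u‖ ^ 2 ≤ (conj u * u').re) (hv : (conj v * v').re ≤ 0) :
    k * (‖u‖ * ‖v‖) ≤ ‖u * v' - v * u'‖ := by
  have h := (abs_le.1 (growth_pairing_abs_le u u' v v')).1
  have h1 : k * (‖u‖ ^ 2 * ‖v‖ ^ 2) ≤ ‖u‖ * ‖v‖ * ‖u * v' - v * u'‖ := by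
    have hu2 : 0 ≤ ‖u‖ ^ 2 := sq_nonneg _
    have hv2 : 0 ≤ ‖v‖ ^ 2 := sq_nonneg _
    nlinarith [mul_le_mul_of_nonneg_left hu hv2, mul_nonpos_of_nonneg_of_nonpos hu2 hv]
  have hp : 0 ≤ ‖u‖ * ‖v‖ := by positivity
  rcases hp.lt_or_eq with hpos | hzero
  · have h2 : k * (‖u‖ * ‖v‖) * (‖u‖ * ‖v‖) ≤ ‖u * v' - v * u'‖ * (‖u‖ * ‖v‖) := by
      calc k * (‖u‖ * ‖v‖) * (‖u‖ * ‖v‖) = k * (‖u‖ ^ 2 * ‖v‖ ^ 2) := by ring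
        _ ≤ ‖u‖ * ‖v‖ * ‖u * v' - v * u'‖ := h1
        _ = ‖u * v' - v * u'‖ * (‖u‖ * ‖v‖) := by ring
    exact le_of_mul_le_mul_right h2 hpos
  · rw [← hzero, mul_zero]
    exact norm_nonneg _

/-- **Two-point kernel bound from growth rates.** Let `u, v, u′, v′ : ℝ → ℂ`. If `|u|` is
non-decreasing between `x ≤ y`, `u` is outward-growing at `y` (`Re(ū u′)(y) ≥ 0`) and `v` is
inward-growing at `y` at rate `k ≥ 0` (`Re(v̄ v′)(y) ≤ −k|v(y)|²`), then
`k·|u(x)||v(y)| ≤ |u(y) v′(y) − v(y) u′(y)|` (for solutions of one real equation the right-hand side is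
the constant Wronskian). [folklore] -/
theorem two_point_le_norm_wronskian_of_growth {u u' v v' : ℝ → ℂ} {x y k : ℝ} (hk : 0 ≤ k)
    (hmono : ‖u x‖ ≤ ‖u y‖) (hu : 0 ≤ (conj (u y) * u' y).re)
    (hv : (conj (v y) * v' y).re ≤ -k * ‖v y‖ ^ 2) :
    k * (‖u x‖ * ‖v y‖) ≤ ‖u y * v' y - v y * u' y‖ := by
  have h := mul_norm_le_norm_wronskian_of_growth hu hv
  have h1 : k * (‖u x‖ * ‖v y‖) ≤ k * (‖u y‖ * ‖v y‖) :=
    mul_le_mul_of_nonneg_left (mul_le_mul_of_nonneg_right hmono (norm_nonneg _)) hk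
  exact h1.trans h

/-- **Diagonal kernel from signed growth rates.** If `Re(ū u′) ≥ −k₁|u|²` (`u` shrinks at rate at most `k₁`) and
`Re(v̄ v′) ≤ −k₂|v|²` (`v` is inward-growing at rate at least `k₂`), then `(k₂ − k₁)·|u||v| ≤ |u v′ − v u′|`.
[folklore] -/
theorem mul_norm_le_norm_wronskian_of_rates {u u' v v' : ℂ} {k₁ k₂ : ℝ}
    (hu : -k₁ * ‖u‖ ^ 2 ≤ (conj u * u').re) (hv : (conj v * v').re ≤ -k₂ * ‖v‖ ^ 2) :
    (k₂ - k₁) * (‖u‖ * ‖v‖) ≤ ‖u * v' - v * u'‖ := by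
  have h := (abs_le.1 (growth_pairing_abs_le u u' v v')).1
  have h1 : (k₂ - k₁) * (‖u‖ ^ 2 * ‖v‖ ^ 2) ≤ ‖u‖ * ‖v‖ * ‖u * v' - v * u'‖ := by
    have hu2 : 0 ≤ ‖u‖ ^ 2 := sq_nonneg _
    have hv2 : 0 ≤ ‖v‖ ^ 2 := sq_nonneg _
    nlinarith [mul_le_mul_of_nonneg_left hv hu2, mul_le_mul_of_nonneg_left hu hv2]
  have hp : 0 ≤ ‖u‖ * ‖v‖ := by positivity
  rcases hp.lt_or_eq with hpos | hzero
  · have h2 : (k₂ - k₁) * (‖u‖ * ‖v‖) * (‖u‖ * ‖v‖) ≤ ‖u * v' - v * u'‖ * (‖u‖ * ‖v‖) := by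
      calc (k₂ - k₁) * (‖u‖ * ‖v‖) * (‖u‖ * ‖v‖) = (k₂ - k₁) * (‖u‖ ^ 2 * ‖v‖ ^ 2) := by ring
        _ ≤ ‖u‖ * ‖v‖ * ‖u * v' - v * u'‖ := h1
        _ = ‖u * v' - v * u'‖ * (‖u‖ * ‖v‖) := by ring
    exact le_of_mul_le_mul_right h2 hpos
  · rw [← hzero, mul_zero]
    exact norm_nonneg _

/-- **Two-point kernel bound from signed growth rates and quasi-monotonicity.** If `|u(x)| ≤ A|u(y)|` (`A ≥ 0`),
`Re(ū u′)(y) ≥ −k₁|u(y)|²`, `Re(v̄ v′)(y) ≤ −k₂|v(y)|²` and `k₁ ≤ k₂`, then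
`(k₂ − k₁)·|u(x)||v(y)| ≤ A·|u(y) v′(y) − v(y) u′(y)|`. [folklore] -/
theorem two_point_le_norm_wronskian_of_rates {u u' v v' : ℝ → ℂ} {x y k₁ k₂ A : ℝ} (hA : 0 ≤ A)
    (hk : k₁ ≤ k₂) (hmono : ‖u x‖ ≤ A * ‖u y‖) (hu : -k₁ * ‖u y‖ ^ 2 ≤ (conj (u y) * u' y).re)
    (hv : (conj (v y) * v' y).re ≤ -k₂ * ‖v y‖ ^ 2) :
    (k₂ - k₁) * (‖u x‖ * ‖v y‖) ≤ A * ‖u y * v' y - v y * u' y‖ := by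
  have h := mul_norm_le_norm_wronskian_of_rates hu hv
  have hk' : 0 ≤ k₂ - k₁ := sub_nonneg.2 hk
  have h1 : (k₂ - k₁) * (‖u x‖ * ‖v y‖) ≤ (k₂ - k₁) * (A * ‖u y‖ * ‖v y‖) :=
    mul_le_mul_of_nonneg_left (mul_le_mul_of_nonneg_right hmono (norm_nonneg _)) hk'
  calc (k₂ - k₁) * (‖u x‖ * ‖v y‖) ≤ (k₂ - k₁) * (A * ‖u y‖ * ‖v y‖) := h1
    _ = A * ((k₂ - k₁) * (‖u y‖ * ‖v y‖)) := by ring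
    _ ≤ A * ‖u y * v' y - v y * u' y‖ := mul_le_mul_of_nonneg_left h hA

end Literature.Analysis.ODE

end
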